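import Literature.Geometry.Riemannian.MetricFlowFDistance
import Literature.Geometry.Riemannian.WassersteinW1Triangle
import Mathlib.Topology.MetricSpace.Kuratowski
import HarnessLib

/-!
# The `𝔽`-distance of a metric flow pair to itself vanishes (Bamler 2023, §5.2, Thm. 5.13, the
# trivial direction)

R. Bamler, *Compactness theory of the space of super Ricci flows*, Invent. Math. 233 (2023),
§5.2, Theorem (`(𝔽^J_I, d^J_𝔽)` is a metric space): in particular `d^J_𝔽(𝒳, 𝒳) = 0`. The source
does not spell this direction out; the witness is the **self-correspondence** of a metric flow
pair — all time-slices `𝒳_t`, `t ∈ I'`, embedded isometrically into ONE comparison space (here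
`ℓ^∞(ℕ, ℝ)` by the Kuratowski embedding, the slices being separable), both families of embeddings
equal — together with the diagonal couplings `q_t := (id, id)_* μ_t` and the exceptional set
`E := I ∖ I'` (`|E| = 0`): the integrand of Definition (𝔽-distance within a correspondence) is
`d_{W₁}((φ_s)_* ν_{x;s}, (φ_s)_* ν_{x;s}) = 0` on the diagonal, so every `r > 0` is admissible and
`d^{ℭ,J}_𝔽 = 0`, whence `d^J_𝔽(𝒳, 𝒳) = 0` (`MetricFlowPair.fDist_self`).

The tree's Definition requires the exceptional set `E` to be MEASURABLE (Bamler: "a measurable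
subset `E ⊂ I''`"); for the self-distance this forces the hypothesis that `I ∖ I'` be measurable
(automatic when `I` and `I'` are Borel), which we carry explicitly.

## References

* R. H. Bamler, *Compactness theory of the space of super Ricci flows*, Invent. Math. 233 (2023),
  1121–1277, §5.1 Definitions (correspondence, 𝔽-distance within a correspondence, 𝔽-distance),
  §5.2 Theorem (metric space). [Bamler2023]
-/

noncomputable section

open Set MeasureTheory Filter TopologicalSpace Function
open scoped Topology ENNReal NNReal

namespace Literature.Geometry.Riemannian

universe u

namespace MetricFlowPair

open MetricFlow

variable {I : Set ℝ}

/-- The common comparison space of the self-correspondence: a copy of `ℓ^∞(ℕ, ℝ)` in the universe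
of the flow. [cite: Bamler2023, §5.1, Definition (Correspondence)] -/
abbrev SelfSpace : Type u := ULift.{u} (lp (fun _ : ℕ ↦ ℝ) ∞)

/-- The Borel σ-algebra on the comparison space. [cite: Bamler2023, §5.1, Definition (Correspondence)] -/
instance instMeasurableSpaceSelfSpace : MeasurableSpace SelfSpace.{u} := borel _

/-- The comparison space carries its Borel σ-algebra. [cite: Bamler2023, §5.1, Definition (Correspondence)] -/
instance instBorelSpaceSelfSpace : BorelSpace SelfSpace.{u} := ⟨rfl⟩

/-- The embedding of a time-slice into the comparison space: the Kuratowski embedding of the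
(separable) slice into `ℓ^∞(ℕ, ℝ)`, lifted. [cite: Bamler2023, §5.1, Definition (Correspondence)] -/
def selfEmbedding (P : MetricFlowPair.{u} I) (t : P.I') : P.flow.Slice t → SelfSpace.{u} :=
  fun x ↦ ULift.up (kuratowskiEmbedding (P.flow.Slice t) x)

/-- The slice embeddings are isometric embeddings. [cite: Bamler2023, §5.1, Definition (Correspondence)] -/
theorem isometry_selfEmbedding (P : MetricFlowPair.{u} I) (t : P.I') :
    Isometry (P.selfEmbedding t) := by
  intro x y
  exact (kuratowskiEmbedding.isometry (P.flow.Slice t)) x y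

/-- The slice embeddings are measurable (continuous into a Borel space).
[cite: Bamler2023, §5.1, Definition (Correspondence)] -/
theorem measurable_selfEmbedding (P : MetricFlowPair.{u} I) (t : P.I') :
    Measurable (P.selfEmbedding t) :=
  (P.isometry_selfEmbedding t).continuous.measurable

/-- **The self-correspondence of a metric flow pair over `I`** (a correspondence between `𝒳` and
itself over `I''= I`, fully defined over `I'`): comparison spaces `Z_t := ℓ^∞(ℕ, ℝ)` for all
`t ∈ I`, domains `I''^{,1} = I''^{,2} = I'`, and `φ¹_t = φ²_t` the Kuratowski embedding of `𝒳_t`.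
[cite: Bamler2023, §5.1, Definition (Correspondence)] -/
def selfCorrespondence (P : MetricFlowPair.{u} I) : Correspondence₂ P.flow P.flow I where
  Z := fun _ ↦ SelfSpace.{u}
  dom₁ := P.I'
  dom₂ := P.I'
  dom₁_subset := fun _ ht ↦ ⟨ht, P.subset ht⟩
  dom₂_subset := fun _ ht ↦ ⟨ht, P.subset ht⟩
  φ₁ := fun t ht ↦ P.selfEmbedding ⟨t, ht⟩
  φ₂ := fun t ht ↦ P.selfEmbedding ⟨t, ht⟩
  isometry₁ := fun t ht ↦ P.isometry_selfEmbedding ⟨t, ht⟩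
  isometry₂ := fun t ht ↦ P.isometry_selfEmbedding ⟨t, ht⟩

/-- The self-correspondence is fully defined over every `J ⊆ I'`.
[cite: Bamler2023, §5.1, Definition (Correspondence)] -/
theorem selfCorrespondence_fullyDefinedOver (P : MetricFlowPair.{u} I) {J : Set ℝ}
    (hJ : P.FullyDefinedOver J) : P.selfCorrespondence.FullyDefinedOver J :=
  ⟨hJ, hJ⟩

/-- On the diagonal the integrand of the `𝔽`-distance within the self-correspondence vanishes:
`d_{W₁}^{Z_s}((φ_s)_* ν_{x;s}, (φ_s)_* ν_{x;s}) = 0` for `s ≤ t = 𝔱(x)` (push-forward does not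
increase `d_{W₁}`, and `d_{W₁}(ν, ν) = 0` for the probability measure `ν_{x;s}` on the separable
slice). [cite: Bamler2023, §5.1, Definition (F-distance within correspondence)] -/
theorem kernelDistWithin_selfCorrespondence_diag (P : MetricFlowPair.{u} I) {s t : ℝ}
    (hs : s ∈ P.I') (ht : t ∈ P.I') (hst : s ≤ t) (x : P.flow.Slice ⟨t, ht⟩) :
    kernelDistWithin P P P.selfCorrespondence hs hs ht ht (x, x) = 0 := by
  haveI := P.flow.isProbabilityMeasure_condKernel x (s := ⟨s, hs⟩) hst
  refine le_antisymm ?_ zero_le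
  calc kernelDistWithin P P P.selfCorrespondence hs hs ht ht (x, x)
      ≤ wassersteinW1 (P.flow.condKernel x ⟨s, hs⟩) (P.flow.condKernel x ⟨s, hs⟩) :=
        wassersteinW1_map_le_of_edist_le (P.measurable_selfEmbedding ⟨s, hs⟩)
          (fun a b ↦ ((P.isometry_selfEmbedding ⟨s, hs⟩).edist_eq a b).le) _ _
    _ = 0 := wassersteinW1_self _

/-- **Every radius is admissible for the self-correspondence**: with `E := I ∖ I'` (measure zero,
assumed measurable) and the diagonal couplings `q_t := (id, id)_* μ_t`, conditions (1)–(2) of the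
Definition hold with every `r > 0`. [cite: Bamler2023, §5.1, Definition (F-distance within correspondence)] -/
theorem fDistAdmissible_selfCorrespondence (P : MetricFlowPair.{u} I) {J : Set ℝ}
    (hJ : P.FullyDefinedOver J) (hE : MeasurableSet (I \ P.I')) {r : ℝ} (hr : 0 < r) :
    FDistAdmissible P P P.selfCorrespondence J r := by
  have hIE : I \ (I \ P.I') = P.I' := by
    ext t
    constructor
    · rintro ⟨htI, hnot⟩
      by_contra h'
      exact hnot ⟨htI, h'⟩
    · intro ht
      exact ⟨P.subset ht, fun h' ↦ h'.2 ht⟩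
  refine ⟨hr, I \ P.I', hE, fun t ht ↦ ht.1, fun t ht ↦ ?_, fun t ht ↦ ?_, fun t ht ↦ ?_, ?_,
    ?_, ?_, ?_⟩
  · rw [hIE]; exact hJ ht
  · rw [hIE] at ht; exact ht
  · rw [hIE] at ht; exact ht
  · rw [P.volume_diff]; exact zero_le
  · exact fun t ht ↦ (P.μ ⟨t, by rw [hIE] at ht; exact ht⟩).map fun x ↦ (id x, id x)
  · intro t ht
    have ht' : t ∈ P.I' := by rw [hIE] at ht; exact ht
    haveI := P.isProbabilityMeasure_μ ⟨t, ht'⟩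
    refine ⟨Measure.isProbabilityMeasure_map (measurable_id.prodMk measurable_id).aemeasurable,
      ?_, ?_⟩
    · rw [Measure.fst_map_prodMk measurable_id, Measure.map_id]
    · rw [Measure.snd_map_prodMk measurable_id, Measure.map_id]
  · intro s hs t ht hst
    have hs' : s ∈ P.I' := by rw [hIE] at hs; exact hs
    have ht' : t ∈ P.I' := by rw [hIE] at ht; exact ht
    refine le_trans (lintegral_map_le _ _) ?_
    have h0 : ∀ x : P.flow.Slice ⟨t, ht'⟩,
        kernelDistWithin P P P.selfCorrespondence hs' hs' ht' ht' (id x, id x) = 0 :=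
      fun x ↦ P.kernelDistWithin_selfCorrespondence_diag hs' ht' hst x
    simp only [h0, lintegral_zero]
    exact zero_le

/-- **The `𝔽`-distance within the self-correspondence vanishes.**
[cite: Bamler2023, §5.2, Theorem (metric space)] -/
theorem fDistWithin_selfCorrespondence (P : MetricFlowPair.{u} I) {J : Set ℝ}
    (hJ : P.FullyDefinedOver J) (hE : MeasurableSet (I \ P.I')) :
    fDistWithin P P P.selfCorrespondence J = 0 := by
  refine le_antisymm ?_ zero_le
  have hle : ∀ r : ℝ, 0 < r → fDistWithin P P P.selfCorrespondence J ≤ ENNReal.ofReal r :=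
    fun r hr ↦ fDistWithin_le (P.fDistAdmissible_selfCorrespondence hJ hE hr)
  refine ENNReal.le_of_forall_pos_le_add fun ε hε _ ↦ ?_
  rw [zero_add, ← ENNReal.ofReal_coe_nnreal]
  exact hle ε (NNReal.coe_pos.2 hε)

/-- **`d^J_𝔽(𝒳, 𝒳) = 0`** for a metric flow pair `𝒳` over `I` fully defined over `J`, provided
the null set `I ∖ I'` is measurable (Bamler 2023, §5.2, Theorem: `(𝔽^J_I, d^J_𝔽)` is a metric
space — the reflexivity part; witness: the self-correspondence). `J ⊆ I` is automatic.
[cite: Bamler2023, §5.2, Theorem (metric space)] -/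
theorem fDist_self (P : MetricFlowPair.{u} I) {J : Set ℝ} (hJ : P.FullyDefinedOver J)
    (hE : MeasurableSet (I \ P.I')) : fDist J P P = 0 :=
  le_antisymm ((fDist_le_fDistWithin P.selfCorrespondence
    (P.selfCorrespondence_fullyDefinedOver hJ)).trans_eq
      (P.fDistWithin_selfCorrespondence hJ hE)) zero_le

end MetricFlowPair

end Literature.Geometry.Riemannian

end
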